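import Mathlib
import Summits.Ventures.HodgeRepro.BallGenRational

/-!
# Sylvester: a Hermitian form of signature `(p,1)` is congruent to `J`; its unitary group inside `U(p,1)`

Blind re-derivation cell `pub-hodge-repro`, seat `typer-2` (gen 3).  The Picard modular surfaces of ROUTE.md Route C
are ball quotients for unitary groups of Hermitian forms `(V, h)` over a CM field `K` of signature `(p,1)` at one
embedding — not necessarily the split form `J`.  Here: a Hermitian `H ∈ M_{p+1}(ℂ)` of SIGNATURE `(p,1)` (`p` positive,
one negative eigenvalue, `IsSignatureP1`) is congruent to `J` — `exists_congruent_J : ∃ P ∈ GL, Pᴴ H P = J` — by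
Mathlib's spectral theorem (`Matrix.IsHermitian.spectral_theorem`), a diagonal rescaling and a permutation; the
unitary group `unitaryOf H = {g : gᴴ H g = H}` is then conjugated into `U(p,1)` (`conjToU P`).  For a Hermitian
matrix `H_K` over the CM field `K` whose image under `φ₀ : K → ℂ` has signature `(p,1)`: the `K`-points `UKof H_K`, their
image `ratPointsOf P φ₀ ≤ U(p,1)`, and `lemmaW_rational_of` = Lemma W on these rational points, again with the printed
real-approximation density as its one hypothesis.  This discharges the `TODO(general form)` of `BallGenRational.lean`.
-/

set_option autoImplicit false

noncomputable section

namespace HodgeRepro.BallGen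

open Matrix Finset NumberField

variable {p : ℕ}

/-! ### The unitary group of an arbitrary form -/

/-- `{g ∈ GL_{p+1}(ℂ) : gᴴ H g = H}`. -/
def unitaryOf (H : Matrix (Idx p) (Idx p) ℂ) : Subgroup (GLp p) where
  carrier := {g | (g : Matrix (Idx p) (Idx p) ℂ)ᴴ * H * (g : Matrix (Idx p) (Idx p) ℂ) = H}
  mul_mem' := by
    intro g h hg hh
    simp only [Set.mem_setOf_eq, Units.val_mul, conjTranspose_mul] at hg hh ⊢
    calc (h : Matrix (Idx p) (Idx p) ℂ)ᴴ * (g : Matrix (Idx p) (Idx p) ℂ)ᴴ * H *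
          ((g : Matrix (Idx p) (Idx p) ℂ) * (h : Matrix (Idx p) (Idx p) ℂ))
        = (h : Matrix (Idx p) (Idx p) ℂ)ᴴ * ((g : Matrix (Idx p) (Idx p) ℂ)ᴴ * H *
          (g : Matrix (Idx p) (Idx p) ℂ)) * (h : Matrix (Idx p) (Idx p) ℂ) := by
          simp only [Matrix.mul_assoc]
      _ = H := by rw [hg, hh]
  one_mem' := by simp
  inv_mem' := by
    intro g hg
    simp only [Set.mem_setOf_eq] at hg ⊢
    set gi : Matrix (Idx p) (Idx p) ℂ := ((g⁻¹ : GLp p) : Matrix (Idx p) (Idx p) ℂ) with hgi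
    have hmul : (g : Matrix (Idx p) (Idx p) ℂ) * gi = 1 := by
      rw [hgi, ← Units.val_mul, mul_inv_cancel, Units.val_one]
    calc giᴴ * H * gi = giᴴ * ((g : Matrix (Idx p) (Idx p) ℂ)ᴴ * H * (g : Matrix (Idx p) (Idx p) ℂ)) * gi := by
          rw [hg]
      _ = ((g : Matrix (Idx p) (Idx p) ℂ) * gi)ᴴ * H * ((g : Matrix (Idx p) (Idx p) ℂ) * gi) := by
          simp only [conjTranspose_mul, Matrix.mul_assoc]
      _ = H := by rw [hmul]; simp

/-- Membership in `unitaryOf H`. -/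
theorem mem_unitaryOf {H : Matrix (Idx p) (Idx p) ℂ} (g : GLp p) :
    g ∈ unitaryOf H ↔ (g : Matrix (Idx p) (Idx p) ℂ)ᴴ * H * (g : Matrix (Idx p) (Idx p) ℂ) = H := Iff.rfl

/-- `U(p,1)` is the unitary group of `J`. -/
theorem mem_U_iff (g : GLp p) : g ∈ U p ↔ g ∈ unitaryOf (J p) := Iff.rfl

/-! ### Conjugating `unitaryOf H` into `U(p,1)` -/

/-- If `Pᴴ H P = J` then `g ↦ P⁻¹ g P` maps `unitaryOf H` into `U(p,1)`. -/
theorem conj_mem_U {H : Matrix (Idx p) (Idx p) ℂ} {P : GLp p}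
    (hP : (P : Matrix (Idx p) (Idx p) ℂ)ᴴ * H * (P : Matrix (Idx p) (Idx p) ℂ) = J p) {g : GLp p}
    (hg : g ∈ unitaryOf H) : P⁻¹ * g * P ∈ U p := by
  rw [mem_unitaryOf] at hg
  show ((P⁻¹ * g * P : GLp p) : Matrix (Idx p) (Idx p) ℂ)ᴴ * J p * ((P⁻¹ * g * P : GLp p) : Matrix (Idx p) (Idx p) ℂ) = J p
  set Pm : Matrix (Idx p) (Idx p) ℂ := (P : Matrix (Idx p) (Idx p) ℂ) with hPm
  set Pi : Matrix (Idx p) (Idx p) ℂ := ((P⁻¹ : GLp p) : Matrix (Idx p) (Idx p) ℂ) with hPi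
  set gm : Matrix (Idx p) (Idx p) ℂ := (g : Matrix (Idx p) (Idx p) ℂ) with hgm
  have h1 : Pm * Pi = 1 := by rw [hPm, hPi, ← Units.val_mul, mul_inv_cancel, Units.val_one]
  have hval : ((P⁻¹ * g * P : GLp p) : Matrix (Idx p) (Idx p) ℂ) = Pi * gm * Pm := by
    simp only [Units.val_mul, hPm, hPi, hgm]
  rw [hval, ← hP]
  calc (Pi * gm * Pm)ᴴ * (Pmᴴ * H * Pm) * (Pi * gm * Pm)
      = Pmᴴ * gmᴴ * ((Pm * Pi)ᴴ * H * (Pm * Pi)) * gm * Pm := by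
        simp only [conjTranspose_mul, Matrix.mul_assoc]
    _ = Pmᴴ * (gmᴴ * H * gm) * Pm := by rw [h1]; simp [Matrix.mul_assoc]
    _ = Pmᴴ * H * Pm := by rw [hg]

/-- The conjugation `unitaryOf H →* U(p,1)` by a matrix `P` with `Pᴴ H P = J`. -/
def conjToU {H : Matrix (Idx p) (Idx p) ℂ} (P : GLp p)
    (hP : (P : Matrix (Idx p) (Idx p) ℂ)ᴴ * H * (P : Matrix (Idx p) (Idx p) ℂ) = J p) : unitaryOf H →* U p where
  toFun g := ⟨P⁻¹ * g * P, conj_mem_U hP g.2⟩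
  map_one' := by
    apply Subtype.ext
    show P⁻¹ * (1 : GLp p) * P = 1
    simp
  map_mul' g h := by
    apply Subtype.ext
    show P⁻¹ * ((g : GLp p) * (h : GLp p)) * P = P⁻¹ * (g : GLp p) * P * (P⁻¹ * (h : GLp p) * P)
    group

/-- The matrix of `conjToU P hP g`. -/
theorem mat_conjToU {H : Matrix (Idx p) (Idx p) ℂ} (P : GLp p)
    (hP : (P : Matrix (Idx p) (Idx p) ℂ)ᴴ * H * (P : Matrix (Idx p) (Idx p) ℂ) = J p) (g : unitaryOf H) :
    mat (conjToU P hP g) = ((P⁻¹ : GLp p) : Matrix (Idx p) (Idx p) ℂ) * ((g : GLp p) : Matrix (Idx p) (Idx p) ℂ) *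
      (P : Matrix (Idx p) (Idx p) ℂ) := rfl

/-! ### Signature `(p,1)` and Sylvester's normal form -/

/-- `H` Hermitian has signature `(p, 1)`: `p` positive and one negative eigenvalue. -/
def IsSignatureP1 {H : Matrix (Idx p) (Idx p) ℂ} (hH : H.IsHermitian) : Prop :=
  (univ.filter fun i => 0 < hH.eigenvalues i).card = p ∧ (univ.filter fun i => hH.eigenvalues i < 0).card = 1

/-- `|Fin p ⊕ Unit| = p + 1`. -/
theorem card_Idx : Fintype.card (Idx p) = p + 1 := by simp

/-- Under signature `(p,1)` the non-positive eigenvalues are exactly the negative ones. -/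
theorem filter_not_pos_eq {H : Matrix (Idx p) (Idx p) ℂ} {hH : H.IsHermitian} (hs : IsSignatureP1 hH) :
    (univ.filter fun i => ¬ 0 < hH.eigenvalues i) = univ.filter fun i => hH.eigenvalues i < 0 := by
  have hsum := Finset.card_filter_add_card_filter_not (s := (univ : Finset (Idx p))) (fun i => 0 < hH.eigenvalues i)
  rw [hs.1, Finset.card_univ, card_Idx] at hsum
  symm
  apply Finset.eq_of_subset_of_card_le
  · intro i hi
    simp only [Finset.mem_filter, Finset.mem_univ, true_and] at hi ⊢
    exact not_lt.2 hi.le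
  · rw [hs.2]; omega

/-- Under signature `(p,1)` no eigenvalue vanishes. -/
theorem eigenvalues_ne_zero {H : Matrix (Idx p) (Idx p) ℂ} {hH : H.IsHermitian} (hs : IsSignatureP1 hH) (i : Idx p) :
    hH.eigenvalues i ≠ 0 := by
  intro h0
  have hi : i ∈ univ.filter fun i => ¬ 0 < hH.eigenvalues i := by simp [h0]
  rw [filter_not_pos_eq hs] at hi
  simp [h0] at hi

/-- The sign of an eigenvalue as a complex number. -/
def sgn {H : Matrix (Idx p) (Idx p) ℂ} (hH : H.IsHermitian) (i : Idx p) : ℂ := if 0 < hH.eigenvalues i then 1 else -1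

/-- The rescaling `S = diag(|λ_i|^{-1/2})`. -/
def scal {H : Matrix (Idx p) (Idx p) ℂ} (hH : H.IsHermitian) : Matrix (Idx p) (Idx p) ℂ :=
  diagonal fun i => (((Real.sqrt |hH.eigenvalues i|)⁻¹ : ℝ) : ℂ)

/-- `S` is Hermitian (real diagonal). -/
theorem scal_conjTranspose {H : Matrix (Idx p) (Idx p) ℂ} (hH : H.IsHermitian) : (scal hH)ᴴ = scal hH := by
  simp [scal, diagonal_conjTranspose, Complex.conj_ofReal]

/-- `Sᴴ diag(λ) S = diag(sgn λ)` when no eigenvalue vanishes. -/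
theorem scal_diag_scal {H : Matrix (Idx p) (Idx p) ℂ} {hH : H.IsHermitian} (hs : IsSignatureP1 hH) :
    (scal hH)ᴴ * diagonal (RCLike.ofReal ∘ hH.eigenvalues) * scal hH = diagonal (sgn hH) := by
  rw [scal_conjTranspose, scal, diagonal_mul_diagonal, diagonal_mul_diagonal]
  congr 1
  funext i
  have hne := eigenvalues_ne_zero hs i
  have hpos : 0 < Real.sqrt |hH.eigenvalues i| := Real.sqrt_pos.2 (abs_pos.2 hne)
  have hss : Real.sqrt |hH.eigenvalues i| * Real.sqrt |hH.eigenvalues i| = |hH.eigenvalues i| :=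
    Real.mul_self_sqrt (abs_nonneg _)
  have hreal : (Real.sqrt |hH.eigenvalues i|)⁻¹ * hH.eigenvalues i * (Real.sqrt |hH.eigenvalues i|)⁻¹ =
      if 0 < hH.eigenvalues i then 1 else -1 := by
    have h1 : (Real.sqrt |hH.eigenvalues i|)⁻¹ * hH.eigenvalues i * (Real.sqrt |hH.eigenvalues i|)⁻¹ =
        hH.eigenvalues i / (Real.sqrt |hH.eigenvalues i| * Real.sqrt |hH.eigenvalues i|) := by
      field_simp
    rw [h1, hss]
    split_ifs with h
    · rw [abs_of_pos h, div_self hne]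
    · rw [abs_of_neg (lt_of_le_of_ne (not_lt.1 h) hne), div_neg, div_self hne]
  have hc : (((Real.sqrt |hH.eigenvalues i|)⁻¹ * hH.eigenvalues i * (Real.sqrt |hH.eigenvalues i|)⁻¹ : ℝ) : ℂ) =
      if 0 < hH.eigenvalues i then 1 else -1 := by
    rw [hreal]; split_ifs <;> simp
  simp only [Function.comp_apply, sgn]
  simpa using hc

/-- A bijection `τ : Fin p ⊕ Unit ≃ Idx p` sending `inl` to the positive and `inr` to the negative eigenvalue
(under signature `(p,1)`). -/
theorem exists_perm {H : Matrix (Idx p) (Idx p) ℂ} {hH : H.IsHermitian} (hs : IsSignatureP1 hH) :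
    ∃ τ : Idx p ≃ Idx p, (∀ i : Fin p, 0 < hH.eigenvalues (τ (Sum.inl i))) ∧ hH.eigenvalues (τ (last p)) < 0 := by
  classical
  have hpos : Fintype.card {i // 0 < hH.eigenvalues i} = p := by
    rw [Fintype.card_subtype]; exact hs.1
  have hneg : Fintype.card {i // ¬ 0 < hH.eigenvalues i} = 1 := by
    rw [Fintype.card_subtype, filter_not_pos_eq hs]; exact hs.2
  let e₁ : Fin p ≃ {i // 0 < hH.eigenvalues i} := (Fintype.equivFinOfCardEq hpos).symm
  let e₂ : Unit ≃ {i // ¬ 0 < hH.eigenvalues i} :=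
    Fintype.equivOfCardEq (by rw [hneg]; simp)
  refine ⟨(Equiv.sumCongr e₁ e₂).trans (Equiv.sumCompl fun i => 0 < hH.eigenvalues i), fun i => ?_, ?_⟩
  · simp only [Equiv.trans_apply, Equiv.sumCongr_apply, Sum.map_inl, Equiv.sumCompl_apply_inl]
    exact (e₁ i).2
  · simp only [last, Equiv.trans_apply, Equiv.sumCongr_apply, Sum.map_inr, Equiv.sumCompl_apply_inr]
    exact lt_of_le_of_ne (not_lt.1 (e₂ ()).2) (eigenvalues_ne_zero hs _)

/-- `sgn ∘ τ` is the diagonal of `J` for the bijection of `exists_perm`. -/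
theorem sgn_comp_eq {H : Matrix (Idx p) (Idx p) ℂ} {hH : H.IsHermitian} {τ : Idx p ≃ Idx p}
    (h₁ : ∀ i : Fin p, 0 < hH.eigenvalues (τ (Sum.inl i))) (h₂ : hH.eigenvalues (τ (last p)) < 0) :
    diagonal (sgn hH ∘ τ) = J p := by
  rw [J]
  congr 1
  funext i
  rcases i with i | i
  · simp [sgn, h₁ i]
  · simp [sgn, not_lt.2 h₂.le]

/-- Conjugating a diagonal matrix by the permutation matrix of `τ.symm` permutes its diagonal by `τ`. -/
theorem perm_conj_diagonal (d : Idx p → ℂ) (τ : Idx p ≃ Idx p) :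
    (Equiv.Perm.permMatrix ℂ τ.symm)ᴴ * diagonal d * Equiv.Perm.permMatrix ℂ τ.symm = diagonal (d ∘ τ) := by
  rw [Matrix.conjTranspose_permMatrix]
  have : (τ.symm⁻¹ : Equiv.Perm (Idx p)) = τ := rfl
  rw [this, Equiv.Perm.permMatrix, Equiv.Perm.permMatrix, PEquiv.toMatrix_toPEquiv_mul, PEquiv.mul_toMatrix_toPEquiv,
    Matrix.submatrix_submatrix, Equiv.symm_symm, Function.comp_id, Function.id_comp, submatrix_diagonal_equiv]

/-- **Sylvester.**  A Hermitian matrix of signature `(p,1)` is congruent to `J`: `∃ P ∈ GL, Pᴴ H P = J`. -/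
theorem exists_congruent_J {H : Matrix (Idx p) (Idx p) ℂ} (hH : H.IsHermitian) (hs : IsSignatureP1 hH) :
    ∃ P : GLp p, (P : Matrix (Idx p) (Idx p) ℂ)ᴴ * H * (P : Matrix (Idx p) (Idx p) ℂ) = J p := by
  classical
  obtain ⟨τ, h₁, h₂⟩ := exists_perm hs
  set Um : Matrix (Idx p) (Idx p) ℂ := (hH.eigenvectorUnitary : Matrix (Idx p) (Idx p) ℂ) with hUm
  have hU : Umᴴ * H * Um = diagonal (RCLike.ofReal ∘ hH.eigenvalues) := by
    have := hH.conjStarAlgAut_star_eigenvectorUnitary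
    rw [Unitary.conjStarAlgAut_star_apply] at this
    rw [hUm, ← Matrix.star_eq_conjTranspose]
    exact this
  set Q : Matrix (Idx p) (Idx p) ℂ := Equiv.Perm.permMatrix ℂ τ.symm with hQ
  set Pm : Matrix (Idx p) (Idx p) ℂ := Um * scal hH * Q with hPm
  have hrel : Pmᴴ * H * Pm = J p := by
    calc Pmᴴ * H * Pm = Qᴴ * ((scal hH)ᴴ * (Umᴴ * H * Um) * scal hH) * Q := by
          simp only [hPm, conjTranspose_mul, Matrix.mul_assoc]
      _ = Qᴴ * diagonal (sgn hH) * Q := by rw [hU, scal_diag_scal hs]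
      _ = J p := by rw [hQ, perm_conj_diagonal, sgn_comp_eq h₁ h₂]
  have hdet : Pm.det ≠ 0 := by
    intro h0
    have := congrArg Matrix.det hrel
    rw [Matrix.det_mul, Matrix.det_mul, h0, mul_zero] at this
    have hJ : (J p).det ≠ 0 := by
      rw [J, det_diagonal]
      simp [Fintype.prod_sum_type]
    exact hJ this.symm
  have hunit : IsUnit Pm := (Matrix.isUnit_iff_isUnit_det Pm).2 (isUnit_iff_ne_zero.2 hdet)
  exact ⟨hunit.unit, by rw [IsUnit.unit_spec]; exact hrel⟩

/-! ### The rational points of a general Hermitian form over a CM field -/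

/-- The unitary group `{g ∈ GL_n(R) : gᴴ H g = H}` of a matrix `H` over a ring with star. -/
def unitaryGroupOf {R : Type*} [CommRing R] [StarRing R] {n : Type*} [Fintype n] [DecidableEq n]
    (H : Matrix n n R) : Subgroup (GL n R) where
  carrier := {g | (g : Matrix n n R)ᴴ * H * (g : Matrix n n R) = H}
  mul_mem' := by
    intro g h hg hh
    simp only [Set.mem_setOf_eq, Units.val_mul, conjTranspose_mul] at hg hh ⊢
    calc (h : Matrix n n R)ᴴ * (g : Matrix n n R)ᴴ * H * ((g : Matrix n n R) * (h : Matrix n n R))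
        = (h : Matrix n n R)ᴴ * ((g : Matrix n n R)ᴴ * H * (g : Matrix n n R)) * (h : Matrix n n R) := by
          simp only [Matrix.mul_assoc]
      _ = H := by rw [hg, hh]
  one_mem' := by simp
  inv_mem' := by
    intro g hg
    simp only [Set.mem_setOf_eq] at hg ⊢
    set gi : Matrix n n R := ((g⁻¹ : GL n R) : Matrix n n R) with hgi
    have hmul : (g : Matrix n n R) * gi = 1 := by
      rw [hgi, ← Units.val_mul, mul_inv_cancel, Units.val_one]
    calc giᴴ * H * gi = giᴴ * ((g : Matrix n n R)ᴴ * H * (g : Matrix n n R)) * gi := by rw [hg]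
      _ = ((g : Matrix n n R) * gi)ᴴ * H * ((g : Matrix n n R) * gi) := by
          simp only [conjTranspose_mul, Matrix.mul_assoc]
      _ = H := by rw [hmul]; simp

/-- Membership in `unitaryGroupOf H`. -/
theorem mem_unitaryGroupOf {R : Type*} [CommRing R] [StarRing R] {n : Type*} [Fintype n] [DecidableEq n]
    {H : Matrix n n R} (g : GL n R) : g ∈ unitaryGroupOf H ↔ (g : Matrix n n R)ᴴ * H * (g : Matrix n n R) = H :=
  Iff.rfl

section CMField

variable {K : Type*} [Field K] [NumberField K] [IsCMField K]

/-- The image of a Hermitian matrix over `K` is Hermitian over `ℂ`. -/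
theorem isHermitian_map (φ₀ : K →+* ℂ) {HK : Matrix (Idx p) (Idx p) K} (hHK : HKᴴ = HK) :
    (HK.map φ₀).IsHermitian := by
  show (HK.map φ₀)ᴴ = HK.map φ₀
  rw [← conjTranspose_map_emb, hHK]

/-- The `K`-points of the unitary group of `(K^{p+1}, H_K)` land in the unitary group of `H_K ⊗ ℂ`. -/
theorem embGL_mem_of (φ₀ : K →+* ℂ) (HK : Matrix (Idx p) (Idx p) K) (g : unitaryGroupOf HK) :
    embGL φ₀ (g : GL (Idx p) K) ∈ unitaryOf (HK.map φ₀) := by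
  rw [mem_unitaryOf, coe_embGL, ← conjTranspose_map_emb, ← Matrix.map_mul, ← Matrix.map_mul]
  rw [(mem_unitaryGroupOf _).1 g.2]

/-- `embUof φ₀ H_K : unitaryGroupOf H_K →* unitaryOf (H_K ⊗ ℂ)`. -/
def embUof (φ₀ : K →+* ℂ) (HK : Matrix (Idx p) (Idx p) K) : unitaryGroupOf HK →* unitaryOf (HK.map φ₀) :=
  ((embGL φ₀).comp (unitaryGroupOf HK).subtype).codRestrict (unitaryOf (HK.map φ₀)) (embGL_mem_of φ₀ HK)

/-- **The rational points of `(V, h) = (K^{p+1}, H_K)` in `U(p,1)`**, along `φ₀` and a Sylvester matrix `P`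
(`Pᴴ (H_K ⊗ ℂ) P = J`): the image of `unitaryGroupOf H_K` under `conjToU P ∘ embUof φ₀`. -/
def ratPointsOf (φ₀ : K →+* ℂ) (HK : Matrix (Idx p) (Idx p) K) (P : GLp p)
    (hP : (P : Matrix (Idx p) (Idx p) ℂ)ᴴ * HK.map φ₀ * (P : Matrix (Idx p) (Idx p) ℂ) = J p) : Subgroup (U p) :=
  ((conjToU P hP).comp (embUof φ₀ HK)).range

/-- A Sylvester matrix exists as soon as `H_K ⊗ ℂ` has signature `(p,1)`. -/
theorem exists_sylvester (φ₀ : K →+* ℂ) {HK : Matrix (Idx p) (Idx p) K} (hHK : HKᴴ = HK)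
    (hs : IsSignatureP1 (isHermitian_map φ₀ hHK)) :
    ∃ P : GLp p, (P : Matrix (Idx p) (Idx p) ℂ)ᴴ * HK.map φ₀ * (P : Matrix (Idx p) (Idx p) ℂ) = J p :=
  exists_congruent_J _ hs

/-- **Lemma W on the rational points of an arbitrary Hermitian form of signature `(p,1)`** (ROUTE.md A4 for the
unitary group of `(V, h)`, `h` any Hermitian form over the CM field `K` of signature `(p,1)` at `φ₀`; the density
`hdense` is the printed real-approximation theorem). -/
theorem lemmaW_rational_of {i : ℕ} (hi : i < p) (φ₀ : K →+* ℂ) (HK : Matrix (Idx p) (Idx p) K) (P : GLp p)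
    (hP : (P : Matrix (Idx p) (Idx p) ℂ)ᴴ * HK.map φ₀ * (P : Matrix (Idx p) (Idx p) ℂ) = J p)
    (hdense : Dense ((ratPointsOf φ₀ HK P hP : Subgroup (U p)) : Set (U p)))
    (v : Ball p → Fin i → Fin p → ℂ) {ω : Ball p → Fin p → ℂ} (hω : Continuous ω)
    (hv : ∃ z, LinearIndependent ℂ (v z)) (hω0 : ∃ w, ω w ≠ 0) :
    ∃ g : unitaryGroupOf HK, ∃ z : Ball p, LinearIndependent ℂ (v z) ∧
      pullback (conjToU P hP (embUof φ₀ HK g)) ω z ∉ Submodule.span ℂ (Set.range (v z)) := by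
  obtain ⟨γ, hγ, z, hz, hγz⟩ := lemmaW_core hi hdense v hω hv hω0
  obtain ⟨g, rfl⟩ := hγ
  exact ⟨g, z, hz, hγz⟩

end CMField

end HodgeRepro.BallGen

end
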